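import Mathlib.Analysis.SpecialFunctions.SmoothTransition
import Summits.AnomalousDissipation.AnomalousDissipation.Theorems.SawtoothPulseCascadeK3LocalisedClosureApproxReduction
import Literature.Analysis.FluidPDE.EulerReynolds

/-!
# K3loc, line `DriftFree` — helper: `ApproximateSolution` from a linearised response on a CLOSED window

Sequel of `…K3LocalisedClosureApproxReduction` (lead prover, crux `K3LocalisedClosure` = stmt-AnomalousDissipation-19492,
stub `stub_approximateSolution` / child `ApproxSol58`).  `DriftFree.ApproximateSolution P r` asks for the approximate
solution `U` on the whole half-open interval `[0,1)`, while the tree's linearised solver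
`Torus.linearisedNSForced_exists` works on closed windows.  `approximateSolution_of_window` closes that gap: it
suffices to have, for every lag `A` and `ε > 0` and all small `ν`, some `T' ∈ (T, 1)` (`T = horizon r ν A`) and a
classical solution `L` on `[0, T'] × 𝕋²` of the linearised equations with the heat-lag source `νΔū` from rest, with
the three LINEAR estimates on `[0, T]` (continuous pointwise strain bound `Λ_L`; `∫₀ᵀ‖L‖² ≤ εν`; Duhamel–Grönwall
smallness of `(L·∇)L` against the rate `½Σⱼ(rateH j + rateV j) + Λ_L`).  The witness is `U = ū + χL` for a smooth
time cutoff `χ` (`= 1` on `[0, (2T+T')/3]`, `= 0` from `(T+2T')/3` on; `FluidPDE.Torus.IsTimeCutoff` bookkeeping of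
`NavierStokesConcentrationTools`), the pressure `χq`, and the defect `ρ` DEFINED as the Navier–Stokes residual of
`U`, which on `[0, T]` is `(L·∇)L` (Grenier's ansatz, `(ū·∇)ū = 0`).  So `ApproxSol58` is now literally: produce `L`
by `linearisedNSForced_exists` on `[0, T']` and prove the three estimates.
-/

-- `Summit.<Summit>.<Problem>`: single-conjunct summit, the duplicate namespace segment is deliberate.
set_option linter.dupNamespace false

noncomputable section

namespace Summit.AnomalousDissipation.AnomalousDissipation.Theorems.SawtoothPulseCascade.DriftFreeApprox

open scoped InnerProductSpace NNReal ContDiff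
open MeasureTheory Set Filter Topology
open Literature.Analysis Literature.Analysis.FunctionSpaces Literature.Analysis.FluidPDE
open Literature.Analysis.FluidPDE.SawtoothCascade
open Literature.Analysis.FluidPDE.SawtoothCascade.DriftFree

/-! ## §B1 A smooth time cutoff: `1` on `(-∞, T₁]`, `0` on `[T₂, ∞)` -/

section Cutoff

variable {T₁ T₂ : ℝ}

/-- The cutoff `χ(t) = smoothTransition ((T₂ − t)/(T₂ − T₁))`: smooth, `= 1` for `t ≤ T₁`, `= 0` for `t ≥ T₂`
(`T₁ < T₂`). [folklore] -/
theorem cutoff_props (h12 : T₁ < T₂) :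
    ContDiff ℝ ∞ (fun t : ℝ => Real.smoothTransition ((T₂ - t) / (T₂ - T₁))) ∧
    (∀ t ≤ T₁, Real.smoothTransition ((T₂ - t) / (T₂ - T₁)) = 1) ∧
    (∀ t ≥ T₂, Real.smoothTransition ((T₂ - t) / (T₂ - T₁)) = 0) := by
  have hpos : 0 < T₂ - T₁ := sub_pos.2 h12
  refine ⟨Real.smoothTransition.contDiff.comp ((contDiff_const.sub contDiff_id).div_const _), fun t ht => ?_,
    fun t ht => ?_⟩
  · exact Real.smoothTransition.one_of_one_le (by rw [le_div_iff₀ hpos]; linarith)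
  · exact Real.smoothTransition.zero_of_nonpos (div_nonpos_of_nonpos_of_nonneg (by linarith) hpos.le)

end Cutoff

/-! ## §B2 `ApproximateSolution` from a linearised response on a closed window -/

/-- **`ApproximateSolution P r` from LINEAR estimates on a CLOSED window.**  For every lag `A` and `ε > 0`, for all small
`ν`, suppose there are `T' ∈ (T, 1)`, `T = horizon r ν A`, and a classical solution `L` (pressure `q`) on
`[0, T'] × 𝕋²` of the Navier–Stokes equations linearised at the cascade carrier with the heat-lag source `νΔū`,
`∂ₜL + (ū·∇)L + (L·∇)ū = νΔL − ∇q + νΔū`, `div L = 0`, `L(0) = 0` — this is what the tree's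
`Torus.linearisedNSForced_exists` provides on any `[0, T']` — with, on `[0, T]`: a continuous pointwise strain bound
`Λ_L`, `∫₀ᵀ ‖L‖² ≤ εν`, and `(∫₀ᵗ e^{∫ₛᵗ(½Σrate + Λ_L)⁺} ‖(L·∇)L(s)‖ ds)² ≤ εν` for `t ≤ T`.  Then
`ApproximateSolution P r`: the witness is `U = ū + χL` with a smooth time cutoff `χ = 1` on `[0, (2T+T')/3]`, `= 0`
from `(T+2T')/3` on (so `U` lives on all of `[0,1)`), the defect `ρ` being DEFINED as the Navier–Stokes residual of
`U` (which is `(L·∇)L` on `[0, T]`, Grenier's ansatz). [folklore] -/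
theorem approximateSolution_of_window (P : CascadeParams) (hγ : 0 ≤ P.γ) (hδ₀ : 0 < P.δ₀) (hd : 0 < P.d) {r : ℝ}
    (h : ∀ A : ℕ, ∀ ε : ℝ, 0 < ε → ∃ ν₀ : ℝ, 0 < ν₀ ∧ ∀ ν ∈ Ioc 0 ν₀, ∃ T' : ℝ,
      horizon r ν A < T' ∧ T' < 1 ∧
      ∃ (L : ℝ → UnitAddTorus (Fin 2) → EuclideanSpace ℝ (Fin 2)) (q : ℝ → UnitAddTorus (Fin 2) → ℝ)
        (ΛL : ℝ → ℝ),
        FunctionSpaces.Torus.IsSmoothSpaceTimeOn (Icc 0 T') L ∧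
        FunctionSpaces.Torus.IsSmoothSpaceTimeOn (Icc 0 T') q ∧
        (∀ t ∈ Icc 0 T', FunctionSpaces.Torus.IsDivFree (L t)) ∧ L 0 = 0 ∧
        (∀ t ∈ Icc 0 T', ∀ x,
          FunctionSpaces.Torus.timeDerivWithin (Icc 0 T') L t x +
              FunctionSpaces.Torus.convect (P.field t) (L t) x + FunctionSpaces.Torus.convect (L t) (P.field t) x =
            ν • FunctionSpaces.Torus.laplacian (L t) x - FunctionSpaces.Torus.gradient (q t) x +
              ν • FunctionSpaces.Torus.laplacian (P.field t) x) ∧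
        (∀ t ∈ Icc 0 (horizon r ν A), ∀ (x : UnitAddTorus (Fin 2)) (ξ : EuclideanSpace ℝ (Fin 2)),
          ⟪ξ, FunctionSpaces.Torus.convect (fun _ => ξ) (L t) x⟫_ℝ ≤ ΛL t * ‖ξ‖ ^ 2) ∧
        ContinuousOn ΛL (Icc 0 (horizon r ν A)) ∧
        (∫ s in (0 : ℝ)..horizon r ν A, FluidPDE.Torus.vectorL2Sq (L s)) ≤ ε * ν ∧
        ∀ t ∈ Icc 0 (horizon r ν A),
          duhamelDefect (fun s => (∑' j, (P.rateH j s + P.rateV j s)) / 2 + ΛL s)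
            (fun s x => FunctionSpaces.Torus.convect (L s) (L s) x) t ^ 2 ≤ ε * ν) :
    ApproximateSolution P r := by
  intro A ε hε
  obtain ⟨ν₀, hν₀, hν⟩ := h A ε hε
  refine ⟨ν₀, hν₀, fun ν hνm => ?_⟩
  obtain ⟨T', hTT', hT'1, L, q, ΛL, hL, hq, hdiv, hL0, hlin, hstr, hΛc, hint, hdef⟩ := hν ν hνm
  have hfs : CascadeFieldSmooth P := cascadeFieldSmooth P hδ₀ hd
  have hU1 : UniqueDiffOn ℝ (Ico (0 : ℝ) 1) := uniqueDiffOn_Ico 0 1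
  have hconv : Convex ℝ (Ico (0 : ℝ) 1) := convex_Ico 0 1
  set T := horizon r ν A with hT
  have hT0 : 0 ≤ T := CascadeParams.tStart_nonneg _
  have hI : Icc 0 T ⊆ Ico (0 : ℝ) 1 := fun s hs => ⟨hs.1, (hs.2.trans_lt hTT').trans hT'1⟩
  have hI' : Icc 0 T' ⊆ Ico (0 : ℝ) 1 := fun s hs => ⟨hs.1, hs.2.trans_lt hT'1⟩
  -- the cutoff
  set T₁ : ℝ := (2 * T + T') / 3 with hT₁
  set T₂ : ℝ := (T + 2 * T') / 3 with hT₂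
  have hT1 : T < T₁ := by simp only [hT₁]; linarith
  have h12 : T₁ < T₂ := by simp only [hT₁, hT₂]; linarith
  have h2' : T₂ < T' := by simp only [hT₂]; linarith
  set χ : ℝ → ℝ := fun t => Real.smoothTransition ((T₂ - t) / (T₂ - T₁)) with hχdef
  obtain ⟨hχs, hχ1, hχ0⟩ := cutoff_props h12
  have hcut : FluidPDE.Torus.IsTimeCutoff (Ico (0 : ℝ) 1) 0 T' χ :=
    ⟨hχs, Or.inl fun s hs => hs.1, Or.inr ⟨T₂, h2', fun t ht => hχ0 t ht⟩⟩
  -- `χ = 1` near every `t ≤ T`: value and derivative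
  have hχ1' : ∀ t ∈ Icc 0 T, χ t = 1 := fun t ht => hχ1 t (ht.2.trans hT1.le)
  have hχd : ∀ t ∈ Icc 0 T, deriv χ t = 0 := by
    intro t ht
    have hev : χ =ᶠ[𝓝 t] fun _ => (1 : ℝ) := by
      filter_upwards [Iio_mem_nhds (lt_of_le_of_lt ht.2 hT1)] with s hs
      exact hχ1 s (le_of_lt hs)
    rw [hev.deriv_eq, deriv_const]
  -- the glued response and pressure
  set Lχ : ℝ → UnitAddTorus (Fin 2) → EuclideanSpace ℝ (Fin 2) := fun t x => χ t • L t x with hLχ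
  set qχ : ℝ → UnitAddTorus (Fin 2) → ℝ := fun t x => χ t • q t x with hqχ
  have hLχs : FunctionSpaces.Torus.IsSmoothSpaceTimeOn (Ico (0 : ℝ) 1) Lχ := hcut.isSmoothSpaceTimeOn_smul hL
  have hqχs : FunctionSpaces.Torus.IsSmoothSpaceTimeOn (Ico (0 : ℝ) 1) qχ := hcut.isSmoothSpaceTimeOn_smul hq
  have hLχ_eq : ∀ t ∈ Icc 0 T, Lχ t = L t := fun t ht => by
    funext x; simp [hLχ, hχ1' t ht]
  have hqχ_eq : ∀ t ∈ Icc 0 T, qχ t = q t := fun t ht => by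
    funext x; simp [hqχ, hχ1' t ht]
  have hLχdiv : ∀ t ∈ Ico (0 : ℝ) 1, FunctionSpaces.Torus.IsDivFree (Lχ t) := by
    intro t ht x
    by_cases hχt : χ t = 0
    · have : Lχ t = fun _ => (0 : EuclideanSpace ℝ (Fin 2)) := by funext y; simp [hLχ, hχt]
      rw [this]; exact FluidPDE.Torus.divergence_zero x
    · have htI : t ∈ Icc 0 T' := hcut.mem_Icc_of_ne_zero ht hχt
      have hL1 : FunctionSpaces.Torus.IsContDiff 1 (L t) := (hL.isSmooth_slice htI).isContDiff (by simp)
      have : Lχ t = χ t • L t := by funext y; simp [hLχ]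
      rw [this, FluidPDE.Torus.divergence_const_smul hL1, hdiv t htI x, mul_zero]
  -- the witness `U = ū + χL`, its residual `ρ`
  set U : ℝ → UnitAddTorus (Fin 2) → EuclideanSpace ℝ (Fin 2) := fun t x => P.field t x + Lχ t x with hUdef
  have hUs : FunctionSpaces.Torus.IsSmoothSpaceTimeOn (Ico (0 : ℝ) 1) U := hfs.add hLχs
  set ρ : ℝ → UnitAddTorus (Fin 2) → EuclideanSpace ℝ (Fin 2) := fun t x =>
    FunctionSpaces.Torus.timeDerivWithin (Ico (0 : ℝ) 1) U t x + FunctionSpaces.Torus.convect (U t) (U t) x -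
      ν • FunctionSpaces.Torus.laplacian (U t) x + FunctionSpaces.Torus.gradient (qχ t) x - planarForce P t x with hρ
  have hNS : FunctionSpaces.Torus.IsClassicalNSSolutionOn (Ico (0 : ℝ) 1) ν (planarForce P + ρ) U qχ :=
    { smooth_velocity := hUs
      smooth_pressure := hqχs
      momentum := fun t _ x => by simp only [hρ, Pi.add_apply]; abel
      divFree := fun t ht =>
        (DriftFreeExistence.isDivFree_field P ht).add ((hfs.isSmooth_slice ht).isContDiff (by simp))
          ((hLχs.isSmooth_slice ht).isContDiff (by simp)) (hLχdiv t ht) }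
  -- on `[0, T]` the residual is `(L·∇)L`
  have hρ_eq : ∀ t ∈ Icc 0 T, ρ t = fun x => FunctionSpaces.Torus.convect (L t) (L t) x := by
    intro t ht
    have ht1 : t ∈ Ico (0 : ℝ) 1 := hI ht
    have htI : t ∈ Icc 0 T' := ⟨ht.1, ht.2.trans hTT'.le⟩
    have hFt : FunctionSpaces.Torus.IsSmooth (P.field t) := hfs.isSmooth_slice ht1
    have hLt : FunctionSpaces.Torus.IsSmooth (L t) := hL.isSmooth_slice htI
    have hF1 : FunctionSpaces.Torus.IsContDiff 1 (P.field t) := hFt.isContDiff (by simp)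
    have hL1 : FunctionSpaces.Torus.IsContDiff 1 (L t) := hLt.isContDiff (by simp)
    -- time derivative of the glued response at `t`: the one of `L` within `[0, T']`
    have hdL : ∀ x, FunctionSpaces.Torus.timeDerivWithin (Ico (0 : ℝ) 1) Lχ t x =
        FunctionSpaces.Torus.timeDerivWithin (Icc 0 T') L t x := by
      intro x
      have hd := hcut.hasDerivWithinAt_smul hL ht1 x
      rw [hχd t ht, hχ1' t ht, zero_smul, one_smul, zero_add] at hd
      exact hd.derivWithin (hU1 t ht1)
    funext x
    have h2 := hlin t htI x
    have h3 : FunctionSpaces.Torus.timeDerivWithin (Icc 0 T') L t x =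
        ν • FunctionSpaces.Torus.laplacian (L t) x - FunctionSpaces.Torus.gradient (q t) x +
          ν • FunctionSpaces.Torus.laplacian (P.field t) x - FunctionSpaces.Torus.convect (P.field t) (L t) x -
          FunctionSpaces.Torus.convect (L t) (P.field t) x := by
      rw [← h2]; abel
    have hUt : U t = fun y => P.field t y + L t y := by
      funext y; simp [hUdef, hLχ, hχ1' t ht]
    simp only [hρ]
    rw [FunctionSpaces.Torus.timeDerivWithin_add hfs hLχs hU1 ht1 x, hdL x, h3, hUt, hqχ_eq t ht,
      FluidPDE.Torus.convect_add_left (P.field t) (L t) (fun y => P.field t y + L t y) x,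
      FluidPDE.Torus.convect_add_right (P.field t) hF1 hL1 x, FluidPDE.Torus.convect_add_right (L t) hF1 hL1 x,
      FluidPDE.Torus.laplacian_add_apply hFt hLt x, convect_field_field P hδ₀ hd ht1 x, ← planarForce_eq P ht1 x,
      smul_add]
    abel
  have hUsub : ∀ s ∈ Icc 0 T, U s - P.field s = L s := fun s hs => by
    funext x; simp [hUdef, hLχ, hχ1' s hs]
  have hTsub : uIcc 0 T ⊆ Icc 0 T := by rw [uIcc_of_le hT0]
  refine ⟨U, ρ, qχ, fun s => (∑' j, (P.rateH j s + P.rateV j s)) / 2 + ΛL s, hNS, ?_, ?_, ?_, ?_, ?_, ?_, ?_⟩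
  · funext x; simp [hUdef, hLχ, field_zero P, hL0]
  · intro t ht x ξ
    have ht' : t ∈ Ico (0 : ℝ) 1 := hI ht
    have hF1 : FunctionSpaces.Torus.IsContDiff 1 (P.field t) := (hfs.isSmooth_slice ht').isContDiff (by simp)
    have hL1 : FunctionSpaces.Torus.IsContDiff 1 (L t) :=
      (hL.isSmooth_slice ⟨ht.1, ht.2.trans hTT'.le⟩).isContDiff (by simp)
    have hUt : U t = fun y => P.field t y + L t y := by
      funext y; simp [hUdef, hLχ, hχ1' t ht]
    rw [hUt, FluidPDE.Torus.convect_add_right (fun _ => ξ) hF1 hL1 x, inner_add_right, add_mul]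
    exact add_le_add (inner_convect_field_le P hγ hδ₀ hd ht' x ξ) (hstr t ht x ξ)
  · exact (continuousOn_rate_sum P ((hTT'.trans hT'1))).add hΛc
  · have hρs : FunctionSpaces.Torus.IsSmoothSpaceTimeOn (Icc 0 T')
        (fun s x => FunctionSpaces.Torus.convect (L s) (L s) x) := hL.convect hL (uniqueDiffOn_Icc (hT0.trans_lt hTT'))
    have hc := (hρs.continuousOn_integral_norm_sq (convex_Icc 0 T')).mono (Icc_subset_Icc le_rfl hTT'.le)
    refine ((Real.continuous_sqrt.comp_continuousOn hc).congr fun s hs => ?_)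
    simp only [Function.comp_apply, FluidPDE.Torus.vectorL2Sq, hρ_eq s hs]
  · refine (((hL.continuousOn_integral_norm_sq (convex_Icc 0 T')).mono (Icc_subset_Icc le_rfl hTT'.le)).congr
      fun s hs => ?_)
    simp only [FluidPDE.Torus.vectorL2Sq, hUsub s hs]
  · calc (∫ s in (0 : ℝ)..T, FluidPDE.Torus.vectorL2Sq (U s - P.field s))
        = ∫ s in (0 : ℝ)..T, FluidPDE.Torus.vectorL2Sq (L s) :=
          intervalIntegral.integral_congr fun s hs => by simp only [hUsub s (hTsub hs)]
      _ ≤ ε * ν := hint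
  · intro t ht
    have hsub : uIcc 0 t ⊆ Icc 0 T := by
      rw [uIcc_of_le ht.1]; exact Icc_subset_Icc le_rfl ht.2
    have e : duhamelDefect (fun s => (∑' j, (P.rateH j s + P.rateV j s)) / 2 + ΛL s) ρ t =
        duhamelDefect (fun s => (∑' j, (P.rateH j s + P.rateV j s)) / 2 + ΛL s)
          (fun s x => FunctionSpaces.Torus.convect (L s) (L s) x) t := by
      unfold duhamelDefect
      exact intervalIntegral.integral_congr fun s hs => by simp only [hρ_eq s (hsub hs)]
    rw [e]; exact hdef t ht

end Summit.AnomalousDissipation.AnomalousDissipation.Theorems.SawtoothPulseCascade.DriftFreeApprox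

end
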